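import Literature.Probability.Percolation.SharpnessQuasiTransitiveMeanField
import Literature.Probability.Percolation.SharpnessQuasiTransitiveSusceptibility
import Literature.Probability.Percolation.GrimmettMarstrand
import HarnessLib

/-!
# Sharpness on quasi-transitive graphs, IV: finite susceptibility below `p_c` (assembly)

Topic `Literature/Probability/Percolation`; family `crit-perc`. Assembly of the Duminil-Copin–
Tassion proof of the **finiteness of the expected cluster size below `p_c`** for Bernoulli bond
percolation on a connected, locally finite graph with finitely many `Aut(G)`-orbits of vertices
(quasi-transitive graphs):

> T. Antunović, I. Veselić, *J. Stat. Phys.* 130 (2008) 983–1009 [AntunovicVeselic2007],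
> Thm. 2: "For every quasi-transitive graph `G` we have `p_T = p_H`" (`p_T = sup{p : E_p|C_v| < ∞}`,
> `p_H = sup{p : P_p(|C_v| = ∞) = 0}`); M. Aizenman, D. J. Barsky, *Comm. Math. Phys.* 108
> (1987) (transitive case); T. Hutchcroft, *C. R. Math.* 354 (2016), Thm. 6 ("the expected
> cluster size is finite for every `p < p_c`. That is, `Σ_x τ_p(ρ, x) < ∞`").

The proof formalised is that of H. Duminil-Copin, V. Tassion, *Comm. Math. Phys.* 343 (2016),
Thm. 1.1 [DuminilCopinTassionCMP2016] (written for transitive graphs, §1: "the proof extends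
to … transitive graphs"; the quasi-transitive case only needs the dichotomy run at each of the
finitely many orbit representatives and the sets `S_u` transported along automorphisms):

* for `p < p_c(G, ρ) = p_c(G, u)` (`criticalProb_eq_of_reachable`, Grimmett 1999 Thm. (2.8)),
  the dichotomy at the root `u` (`exists_phiAt_lt_one_of_lt_criticalProb`,
  `SharpnessQuasiTransitiveMeanField.lean`: Lemma 2.1 + §2.2 would otherwise give `θ_u > 0`
  below `p_c`) yields a finite `S_u ∋ u` with `φ_p(u, S_u) < 1`;
* with one such `S_u` per orbit representative `u ∈ V₀`, transported to every vertex by an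
  automorphism (`phiAt_map`; Antunović–Veselić 2008, §2: "The probability measure is invariant
  under the graph automorphisms"), the family is uniform (`|S| ≤ M`, `φ_p ≤ φ₀ < 1`), and the
  exploration (Simon–Lieb) inequality on truncated susceptibilities with `Λ ↑ V`
  (`summable_real_openConn`, `SharpnessQuasiTransitiveSusceptibility.lean`) gives
  `Σ_x P_p[ρ ⟷ x] < ∞`.

Main result: `summable_real_openConn_of_lt_criticalProb`. The Barriers-side named fact
`Literature.Barriers.CriticalPhenomena.AntunovicVeselic2008_finiteSusceptibility`
(`SubexponentialGrowthZdProofs.lean`, which this `Literature/Probability` file does not import)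
has exactly this statement with `IsQuasiTransitive G` unfolded; its discharge is the one-line
application filed there.
-/

noncomputable section

namespace Literature.Probability.Percolation.DCTQ

open MeasureTheory ProbabilityTheory LatticeModels DCT16 Finset Filter

variable {V : Type*} {G : SimpleGraph V}

/-- A connected, locally finite graph has countably many vertices (`V = ⋃_n B(ρ, n)`, balls
finite). ("which we will always assume to be connected and locally finite", Hutchcroft 2016, §1;
Antunović–Veselić 2008, §2: graphs "infinite, countable, connected".) [folklore] -/
theorem countable_of_connected [DecidableEq V] [G.LocallyFinite] (hc : G.Connected) (ρ : V) :
    Countable V := by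
  have hsub : (Set.univ : Set V) ⊆ ⋃ n : ℕ, (↑(ball G ρ n) : Set V) := by
    intro y _
    obtain ⟨w⟩ := hc.preconnected ρ y
    exact Set.mem_iUnion.2 ⟨w.length, mem_coe.2 (mem_ball_of_walk w le_rfl)⟩
  have hcount : (Set.univ : Set V).Countable :=
    (Set.countable_iUnion fun n => (ball G ρ n).finite_toSet.countable).mono hsub
  exact Set.countable_univ_iff.1 hcount

/-- **Transport of the sets `S_u` along automorphisms** (Duminil-Copin–Tassion 2016, §1.4: `S_u`
"the image of `S` by a fixed automorphism sending `0` to `u`"; Antunović–Veselić 2008, §2): on a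
graph whose vertex orbits under `Aut(G)` all meet the finite set `V₀`, sets `S_u ∋ u` with
`φ_p(u, S_u) < 1` at the representatives `u ∈ V₀` yield at EVERY vertex `u` a finite `S ∋ u` with
`|S| ≤ M := max_{V₀} |S_u|` and `φ_p(u, S) ≤ φ₀ := max_{V₀} φ_p(u, S_u) < 1` (`phiAt_map`).
[cite: DuminilCopinTassionCMP2016, Thm. 1.1(2) (proof, §1.4)] [cite: AntunovicVeselic2007, §2] -/
theorem exists_uniform_sets_of_orbits [DecidableEq V] [G.LocallyFinite] (p : unitInterval)
    {V₀ : Finset V} (hV₀ : ∀ v : V, ∃ γ : G ≃g G, γ v ∈ V₀) (hne : V₀.Nonempty)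
    (hS₀ : ∀ u ∈ V₀, ∃ S : Finset V, u ∈ S ∧ phiAt G p u S < 1) :
    ∃ (M : ℕ) (φ₀ : ℝ), φ₀ < 1 ∧
      ∀ u : V, ∃ S : Finset V, u ∈ S ∧ S.card ≤ M ∧ phiAt G p u S ≤ φ₀ := by
  classical
  -- one set per orbit representative
  have hex : ∀ u : V, ∃ S : Finset V, u ∈ V₀ → (u ∈ S ∧ phiAt G p u S < 1) := by
    intro u
    by_cases hu : u ∈ V₀
    · obtain ⟨S, hS⟩ := hS₀ u hu
      exact ⟨S, fun _ => hS⟩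
    · exact ⟨∅, fun h => absurd h hu⟩
  choose S₀ hS₀' using hex
  set φ₀ : ℝ := V₀.sup' hne fun u => phiAt G p u (S₀ u) with hφ₀def
  set M : ℕ := V₀.sup fun u => (S₀ u).card with hMdef
  have hφ₀ : φ₀ < 1 := (sup'_lt_iff hne).2 fun u hu => (hS₀' u hu).2
  refine ⟨M, φ₀, hφ₀, fun u => ?_⟩
  obtain ⟨γ, hγ⟩ := hV₀ u
  refine ⟨(S₀ (γ u)).map γ.symm.toEquiv.toEmbedding, ?_, ?_, ?_⟩
  · rw [Finset.mem_map]
    exact ⟨γ u, (hS₀' _ hγ).1, by simp⟩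
  · rw [card_map]
    exact le_sup (f := fun u => (S₀ u).card) hγ
  · have h := phiAt_map γ.symm p (γ u) (S₀ (γ u))
    rw [show γ.symm (γ u) = u from γ.symm_apply_apply u] at h
    rw [h]
    exact le_sup' (fun u => phiAt G p u (S₀ u)) hγ

/-- **Finite expected cluster size below `p_c` on quasi-transitive graphs** (Aizenman–Barsky
1987 for transitive graphs; Antunović–Veselić 2008, Thm. 2 (`p_T = p_H`) with Thm. 3 for
quasi-transitive graphs; Hutchcroft 2016, Thm. 6), by the Duminil-Copin–Tassion argument
(CMP 343 (2016), Thm. 1.1): for Bernoulli bond percolation on a connected, locally finite graph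
`G` whose automorphism group has finitely many orbits on vertices (a finite `V₀` met by the
orbit of every vertex), every root `ρ` and every `p < p_c(G, ρ)`,
`x ↦ τ_p(ρ, x) = P_p[ρ ⟷ x]` is summable, i.e. `E_p|C(ρ)| = Σ_x τ_p(ρ, x) < ∞`. Proof: `p_c`
does not depend on the root (`criticalProb_eq_of_reachable`); the dichotomy
`exists_phiAt_lt_one_of_lt_criticalProb` at each `u ∈ V₀`; `exists_uniform_sets_of_orbits`;
`summable_real_openConn`.
[cite: AntunovicVeselic2007, Thm. 2] [cite: DuminilCopinTassionCMP2016, Thm. 1.1 (item 2)]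
[cite: Hutchcroft2016, Thm. 6] -/
theorem summable_real_openConn_of_lt_criticalProb (G : SimpleGraph V) [G.LocallyFinite]
    (hconn : G.Connected) {V₀ : Finset V} (hV₀ : ∀ v : V, ∃ γ : G ≃g G, γ v ∈ V₀) (ρ : V)
    (p : unitInterval) (hp : (p : ℝ) < criticalProb G ρ) :
    Summable fun x : V => (bondPercolation G p).real (openConn ρ x) := by
  classical
  haveI : Countable V := countable_of_connected hconn ρ
  have hpc : ∀ u : V, criticalProb G u = criticalProb G ρ := fun u =>
    criticalProb_eq_of_reachable G (hconn.preconnected u ρ)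
  have hne : V₀.Nonempty := by
    obtain ⟨γ, hγ⟩ := hV₀ ρ
    exact ⟨_, hγ⟩
  have hS₀ : ∀ u ∈ V₀, ∃ S : Finset V, u ∈ S ∧ phiAt G p u S < 1 := fun u _ =>
    exists_phiAt_lt_one_of_lt_criticalProb u p (by rw [hpc u]; exact hp)
  obtain ⟨M, φ₀, hφ₀, hS⟩ := exists_uniform_sets_of_orbits p hV₀ hne hS₀
  exact summable_real_openConn p hφ₀ hS ρ

end Literature.Probability.Percolation.DCTQ

end
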